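import Literature.MathematicalPhysics.QuantumFieldTheory.Balaban1983to89.B8Ineq165Descent
import Literature.MathematicalPhysics.QuantumFieldTheory.Balaban1983to89.B8Eq119TwistedAxial
import Literature.MathematicalPhysics.QuantumFieldTheory.Balaban1983to89.B7TranslationCovariance

/-!
# `Balaban1983to89.B8Eq166ConstraintPair` — T. Bałaban, *Spaces of regular gauge field configurations on a lattice and
# gauge fixing conditions*, Commun. Math. Phys. **99** (1985) 75–102 [Balaban1985RegularSpaces] ("B8"): the hypotheses
# (1.34) (axial gauge `Ax_k(𝔅_k, U₀)`, (1.19) p. 79, with the normalisation (1.14) `u(y) = 1`, `y ∈ 𝔅_k`, p. 78) and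
# (1.66) (p. 87, via (1.65) = the iterated Lemma 1) of **Theorem 4** (p. 88) DISCHARGED FOR A PAIR OF CONFIGURATIONS WITH
# EQUAL `k`-TH AVERAGES — the pair `U₀`, `U` of [Balaban1985Variational] ("B11", CMP **102** (1985) 277–309) (12)–(14)
# p. 280 («U₀ ∈ 𝔘_k({Ω_j}, B₃L³ε₁) ∩ 𝔅_k(𝔅_k, V)», both configurations in the SAME constraint set `𝔅_k(𝔅_k, V)`)

statement-level skeleton of published theorems with citation tags; proofs where landed; nothing here is a claim about the Yang–Mills mass gap

WHY (pub-ymgap Track A, DAG node N16 = spine estimate NE3, seat `pub-ymgap-dag-n16-b`, FIRST-MISSING-ESTIMATE).  Row NE3's END of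
record (`Summit.…Spine.NE3.PairLandauB8EndSfClassHP.ne3EnergyRateWCov_sfClass_small_lineFree`) consumes [B8] Theorem 2 + (1.37) READ AT
THE MINIMISER PAIR `(U₀, U′U₀) := (W, U_A)`, `W` = the rescaled one-step average of the `(k+1)`-run minimiser, `U_A` the `k`-run
minimiser, both with `k`-th average equal to the datum `V` (B11 (3), (13)).  B8 proves Theorem 2 from Theorem 4 (p. 88), whose
hypotheses are (1.33), (1.34), (1.66).  The tree certifies, on the `ℤᵈ` carriers of [Balaban1985Averaging] (`B7Prop1Explicit`,
`B7Prop2Explicit.avgIter`): the axial gauge (1.19) relative to a general background WITH THE TOP LEVEL IN THE AXIAL GAUGE AT ONE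
POINT `y` (`B8Eq119TwistedAxial.twistedFix_global`, normalisation `u(Lᵏy) = 1` at that one point), and (1.65) (`B8Ineq165Descent`).
At the pair, however, print's subgroup (1.14) is `u(y) = 1` for EVERY `y ∈ 𝔅_k ⊇ Λ_k` — the whole top lattice — so that the
constraint `Ū^k = V` is KEPT (p. 78 «the set 𝔅_k(𝔅_k, V) is invariant with respect to gauge transformations u satisfying the
conditions u(y) = 1 for y ∈ 𝔅_k (1.14)»); the one-point top axial gauge of `twistedFix_global` moves `Ū^k`.  This file supplies the
missing PINNED form and reads off (1.34) and (1.66) at such a pair — the first two hypotheses of Theorem 4 at NE3's pair; (1.33)'s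
clause "(3.35) in [4]" and Theorem 4 itself are NOT touched.

THE PRINTED TEXT (verbatim up to OCR; pages = PDF page + 74).  p. 78: «𝔅_k(𝔅_k, V) is a set of all gauge field configurations U
satisfying the conditions Ūʲ = V on Λ_j, j = 0, …, k. (1.13)  Because (\overline{U^u}ʲ)_b = (Ūʲ)ᵘ_b = u(b₋)(Ūʲ)_b u⁻¹(b₊) for
b ⊂ T^{(j)}, hence the set 𝔅_k(𝔅_k, V) is invariant with respect to gauge transformations u satisfying the conditions u(y) = 1 for
y ∈ 𝔅_k. (1.14)  They form a subgroup of the group of all gauge transformations and we are interested in spaces of orbits of this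
subgroup.»  p. 79: «for x₀ ∈ Bʲ(x_j), x_j ∈ Λ_j, 1 ≤ j ≤ k, we define a sequence of points x₀, x₁, …, x_{j−1}, x_j by the conditions
x_n ∈ B(x_{n+1}), n = 0, 1, …, j − 1, and we put (R̄ⁿ_{0,x_{n+1}} Ũ′ⁿ)(Γ_{x_{n+1},x_n}) = ∏_{b⊂Γ_{x_{n+1},x_n}} R(Ū₀ⁿ(Γ_{x_{n+1},b₋})) Ũ′ⁿ_b
= 1. (1.19) … Ũ′ⁿ = (\overline{U′U₀})ⁿ(Ū₀ⁿ)⁻¹. (1.20)  The conditions (1.19) determine uniquely an element in each orbit given by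
the subgroup (1.14). We denote this gauge condition by Ax_k(𝔅_k, U₀).»  p. 82: «U′U₀ ∈ 𝔄_k({Ω_j}, α₀) ∩ Ax_k(𝔅_k, U₀), (1.34)
|(\overline{U′U₀})ʲ − Ū₀ʲ| < α₁ on Λ_j, j = 0, 1, …, k. (1.35) … It is satisfied if V is close to Ū₀ʲ, more precisely if
|V − Ū₀ʲ| < α₁.»  p. 87: «Thus the conditions (1.33)–(1.35) imply |(\overline{U′U₀})ʲ − Ū₀ʲ| = |Ũ′ʲ − 1| < 11d²α₀ + α₁ on
Ω_j^{(j)}. (1.65)  We will assume that the above bounds hold instead of (1.35). For simplicity let us write α₁ instead of the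
right-hand side above, so we assume that |(\overline{U′U₀})ʲ − Ū₀ʲ| = |Ũ′ʲ − 1| < α₁ on Ω_j^{(j)}, j = 0, 1, …, k. (1.66)»
p. 88: «Theorem 4. There exists a constant c₁ such that for arbitrary U₀, U′U₀ satisfying (1.33), (1.34), (1.66) with
α₀ + α₁ ≤ c₁ there exists exactly one gauge transformation u satisfying (1.29) and such that the conditions (1.37), (1.38), (1.62)
hold for the configuration U₁ = U′^{u⁻¹}.»  [Balaban1985Variational] p. 280: «U₀ ∈ 𝔘_k({Ω_j}, B₃L³ε₁) ∩ 𝔅_k(𝔅_k, V), (13) hence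
U₀ should be close to the minimal configuration we are looking for».

WHAT IS CERTIFIED HERE (kernel; axioms `propext`/`Classical.choice`/`Quot.sound`; `ℤᵈ` carriers of the tree as in
`B8Eq115GaugeFixing` / `B8Eq119TwistedAxial` / `B8Ineq165Descent`, whose DICTIONARY is inherited verbatim: every level `Ω^{(j)}` is
`ℤᵈ`, `Ūʲ = avgIter L U j`, `U^{u} = gaugeAct u U`, `Γ_{Lz,x} = treeWord (x − Lz)`, (1.19) ⟺ `Ū^{u,n}(Γ_{Lz,x}) = Ū₀ⁿ(Γ_{Lz,x})`,
`Ũ′ⁿ = pert (avgIter L U^{u} n) (avgIter L U₀ n)`, (1.7) in the global form `pdev · < α·(L^{−k})²` with the Prop. 1∕2 smallness of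
[Balaban1985Averaging] `C₀α ≤ ⅓`, `2α ≤ c₂′`):
* §1 `ptg` — the PINNED tower gauge transformation: print's recursion of p. 98 ∕ (1.15) (`B8Eq115GaugeFixing.tg`) with the top level
  LEFT UNTOUCHED (`u_k ≡ 1`) instead of put in the axial gauge at one point; `ptg_top`: `u(Lᵏz) = 1` for EVERY `z` — (1.14) on all of
  `Λ_k`; `h15_of_cov_pinned`: (1.15) between all consecutive levels from the covariance p. 78; `ptg_periodic`: `u` is
  `N·Lᵏ`-periodic when the levels of the tower are `N·L^{k−j}`-periodic (finite torus `T_η`, `η = L^{−k}`, read on `ℤᵈ`).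
* §2 `pinnedFix_global` — for a `G`-valued `U` (`G` an `AvgClosed` gauge group) under (1.7): `u := ptg L (avgIter L U) k k` and
  `U^{u}` are `G`-valued, plaquette deviations unchanged, (1.15) between all consecutive levels, `u(Lᵏz) = 1` for all `z`, and
  **`\overline{U^{u}}ᵏ = Ūᵏ`** — the constraint (1.13) is KEPT (p. 78 (1.14)).
* §3 `ptw L U₀ U k := (ptg of U₀)⁻¹·(ptg of U)` — the pinned axial gauge RELATIVE TO `U₀`; `pinnedTwistedFix_global`: `G`-valued,
  plaquette deviations unchanged, `u(Lᵏz) = 1` for all `z`, **(1.19) relative to `U₀` between ALL consecutive levels at EVERY block**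
  (hence `U^{u} ∈ Ax_k(ℭ, U₀)` for every family `ℭ`, `inAx_pinnedTwistedFix` — the second clause of (1.34)), and `\overline{U^{u}}ᵏ = Ūᵏ`;
  `ptw_periodic`: `u` is `N·Lᵏ`-periodic for `N·Lᵏ`-periodic `U₀`, `U`.
* §4 **THE PAIR** (`Ūᵏ = Ū₀ᵏ`, B11 (13)): (1.35) holds with `α₁ = 0` after the pinned gauge (`avgIter_pinnedTwistedFix_eq`), hence
  **(1.65) ∕ (1.66) AT THE PAIR**: for every `j ≤ k` and EVERY bond of the `j`-lattice,
  `|\overline{U^{u}}ʲ_b − Ū₀ʲ_b| ≤ 8d²α(1 + L⁻² + … ) < 11d²α` (`ineq165_pair`) and `|Ũ′ʲ_b − 1| < 11d²α` (`ineq166_pair`; everything packaged by ONE name in `exists_pinned_pair`) —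
  Theorem 4's hypothesis (1.66) with `α₁ := 11d²α₀` and NO closeness assumption beyond the common constraint; `exists_box` removes the
  cube bookkeeping of `B8Ineq165Descent` (every bond lies in some tower of cubes).
READING FOR ROW NE3 (no Summits import here; the instantiation is the consumer's one-liner): `U₀ := W = rescale L (bavg L U_B)`,
`U := U_A`, `G := unitaryUnits`, `α` from the small-field class (`MinimalActionRate.rescale_bavg_mem_sfClass` for `W`); the output
`u₀ := ptw L W U_A k` is the unitary `N·Lᵏ`-periodic PRE-GAUGE with `u₀(Lᵏz) = 1` and `U_A^{u₀} = U₀′·W`, `|U₀′ − 1| < 11d²α` on every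
bond, that `Spine/NE3/FrameNormalisation.exists_frameNormalised'` ∕ `FrameNormalisationMembers.members_of_pair` and the Landau step
(`Spine/NE3/CurvedLandauRep`, [B8] Prop. 5 TYPE) take as INPUT (binders `hu₀c`, `hrep₀`, `hr₀`) — at (0)-size `r₀ = 11d²α₀`; the
(−1)-size improvement `|A| < B′₁(α₀ + α₁)(Lʲη)⁻¹` IS Theorem 4 (pp. 88–97), NOT certified here or anywhere in the tree.

HONEST SCOPE.  (i) Nothing of Theorem 4 ∕ Proposition 5 ∕ Theorem 2 is proved; (1.33)'s clause "(3.35) in [4]" is not typed here.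
(ii) `ℤᵈ` at every level (periodic configurations = the torus read on its universal cover), as in the parent files.  (iii) The pinned
gauge is print's subgroup (1.14) restricted to `𝔅_k = Λ_k` = the whole top lattice (the all-small-field torus reading of row NE3,
`Ω_j = T` for all `j`); for a general `𝔅_k = ⋃_j Λ_j` with lower constraint sets the pinning at the lower levels is NOT treated.
(iv) Strict `<` in (1.65)/(1.66) as printed; `α₁ = 0` exactly at the pair (print: "any α₁ > 0").  No Mathlib axiom beyond the
standard three; no `sorry`.
-/

noncomputable section

open scoped BigOperators
open Finset

namespace Literature.MathematicalPhysics.QuantumFieldTheory.Balaban1983to89.B8Eq166ConstraintPair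

open B7Prop1Explicit B7Prop2Explicit B7Prop1Local B7AvgGaugeCovariance B8Ineq130 B8Eq115GaugeFixing B8Eq119TwistedAxial
  B8Ineq165Descent
open B8Lemma1NonAbelian (pert boxVec_nonneg)
open B12Ineq417Flat (shiftCfg shiftCfg_apply hol_shiftCfg)
open B7TranslationCovariance (avgIter_shiftCfg)
export B7Prop1Explicit (Site)

variable {d : ℕ}

/-! ## §1. The PINNED tower gauge transformation (pure gauge algebra, any group `G`) -/

section Algebra

variable {G : Type*} [Group G]

/-- **THE PINNED TOWER GAUGE TRANSFORMATION**: the recursion of p. 98 ∕ (1.15) (`B8Eq115GaugeFixing.tg`) for a tower of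
configurations `W j` (`j` = level, `W k` the top), indexed by the DEPTH `n = k − j`, but with the top level left untouched:
depth `0` (level `k`): `u_k ≡ 1` (print's (1.14) on ALL of `Λ_k`); depth `n + 1` (level `j = k − n − 1`):
`u_j(x) = u_{j+1}(z)·W_j(Γ_{Lz,x})` for `x ∈ B(Lz)`, `z = fl L x`. [cite: Balaban1985RegularSpaces, (1.14)–(1.15) p.78; p.98] -/
def ptg (L : ℕ) (W : ℕ → Site d → Fin d → G) (k : ℕ) : ℕ → Site d → G
  | 0 => fun _ => 1
  | n + 1 => fun x => ptg L W k n (fl L x) * axialFn (W (k - (n + 1))) ((L : ℤ) • fl L x) x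

/-- `ptg_zero` — the top level is untouched. [cite: Balaban1985RegularSpaces, (1.14) p.78] -/
@[simp] theorem ptg_zero (L : ℕ) (W : ℕ → Site d → Fin d → G) (k : ℕ) (x : Site d) : ptg L W k 0 x = 1 := rfl

/-- `ptg_succ` — the recursion `u_j(x) = u_{j+1}(z)·W_j(Γ_{Lz,x})`. [cite: Balaban1985RegularSpaces, (1.15) p.78] -/
theorem ptg_succ (L : ℕ) (W : ℕ → Site d → Fin d → G) (k : ℕ) (n : ℕ) (x : Site d) :
    ptg L W k (n + 1) x = ptg L W k n (fl L x) * axialFn (W (k - (n + 1))) ((L : ℤ) • fl L x) x := rfl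

/-- CONSISTENCY ACROSS LEVELS: `u_j(Lz) = u_{j+1}(z)` (the recursion (1.15)/p. 98 read at a block corner). [cite: Balaban1985RegularSpaces, (1.15) p.78] -/
theorem ptg_succ_smul {L : ℕ} (hL : 1 ≤ L) (W : ℕ → Site d → Fin d → G) (k : ℕ) (n : ℕ) (z : Site d) :
    ptg L W k (n + 1) ((L : ℤ) • z) = ptg L W k n z := by
  rw [ptg_succ, fl_smul hL, axialFn_self, mul_one]

/-- The recursion (1.15)/p. 98 at a block point `x = Lz + r`. [cite: Balaban1985RegularSpaces, (1.15) p.78] -/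
theorem ptg_succ_block {L : ℕ} (hL : 1 ≤ L) (W : ℕ → Site d → Fin d → G) (k : ℕ) (n : ℕ) (z : Site d)
    (r : Fin d → Fin L) :
    ptg L W k (n + 1) ((L : ℤ) • z + boxVec L r) = ptg L W k n z * axialFn (W (k - (n + 1))) ((L : ℤ) • z) ((L : ℤ) • z + boxVec L r) := by
  rw [ptg_succ, fl_block hL]

/-- CONSISTENCY, iterated: `u_m`-values are the `u_{m+j}`-values at `Lʲ`-multiples (the recursion (1.15)/p. 98 down `j` levels). [cite: Balaban1985RegularSpaces, (1.15) p.78] -/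
theorem ptg_add_pow_smul {L : ℕ} (hL : 1 ≤ L) (W : ℕ → Site d → Fin d → G) (k : ℕ) (m : ℕ) :
    ∀ (j : ℕ) (x : Site d), ptg L W k (m + j) (((L : ℤ) ^ j) • x) = ptg L W k m x
  | 0, x => by simp
  | j + 1, x => by
    rw [pow_succ', mul_smul, ← add_assoc, ptg_succ_smul hL, ptg_add_pow_smul hL W k m j x]

/-- **NORMALISATION (1.14) ON THE WHOLE TOP LATTICE**: `u(Lᵏz) = u_k(z) = 1` for EVERY `z` (not only at one centre, as for
`B8Eq115GaugeFixing.tg_top`). [cite: Balaban1985RegularSpaces, (1.14) p.78] -/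
theorem ptg_top {L : ℕ} (hL : 1 ≤ L) (W : ℕ → Site d → Fin d → G) (k : ℕ) (z : Site d) :
    ptg L W k k (((L : ℤ) ^ k) • z) = 1 := by
  have h := ptg_add_pow_smul hL W k 0 k z
  rw [zero_add] at h
  rw [h, ptg_zero]

/-- The trace of the pinned tower gauge on the top lattice is the identity: `u ∘ (Lᵏ·) = 1`. [cite: Balaban1985RegularSpaces, (1.14) p.78] -/
theorem uLev_ptg_top {L : ℕ} (hL : 1 ≤ L) (W : ℕ → Site d → Fin d → G) (k : ℕ) :
    uLev L (ptg L W k k) k = 1 := by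
  funext z
  rw [uLev_apply, ptg_top hL, Pi.one_apply]

/-- The pinned tower gauge transformation of an `S`-valued tower is `S`-valued (gauge transformations (8) of [3] take values in the
gauge group; transporters of `S`-valued configurations are `S`-valued). [cite: Balaban1985Averaging, (8) p.18] -/
theorem ptg_mem {S : Subgroup G} {L : ℕ} {W : ℕ → Site d → Fin d → G} {k : ℕ}
    (hW : ∀ j ≤ k, ∀ x κ, W j x κ ∈ S) : ∀ (n : ℕ) (x : Site d), ptg L W k n x ∈ S
  | 0, x => by rw [ptg_zero]; exact S.one_mem
  | n + 1, x => S.mul_mem (ptg_mem hW n _) (hol_mem_of (hW (k - (n + 1)) (by omega)) _ _)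

/-- **(1.15) FROM THE COVARIANCE**, pinned form: if the levels of the transformed tower are the gauge transforms
`W′_j = (W_j)^{u∘(Lʲ·)}` of the original levels by the traces of `u = ptg … k` (p. 78 «(\overline{U^u}ʲ)_b = (Ūʲ)ᵘ_b»), then
`W′_j(Γ_{Lz,x}) = 1` for every `x ∈ B(Lz)`, every `z`, every `j < k`. [cite: Balaban1985RegularSpaces, (1.15) p.78] -/
theorem h15_of_cov_pinned {L : ℕ} (hL : 1 ≤ L) (W W' : ℕ → Site d → Fin d → G) (k : ℕ)
    (hcov : ∀ j ≤ k, W' j = gaugeAct (uLev L (ptg L W k k) j) (W j))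
    (n : ℕ) (hn : n < k) (z : Site d) (r : Fin d → Fin L) :
    axialFn (W' (k - (n + 1))) ((L : ℤ) • z) ((L : ℤ) • z + boxVec L r) = 1 := by
  have hu : ∀ x, ptg L W k k (((L : ℤ) ^ (k - (n + 1))) • x) = ptg L W k (n + 1) x := fun x => by
    have h := ptg_add_pow_smul hL W k (n + 1) (k - (n + 1)) x
    have hkj : n + 1 + (k - (n + 1)) = k := by omega
    rwa [hkj] at h
  rw [hcov (k - (n + 1)) (by omega)]
  simp only [axialFn_gaugeAct, uLev_apply, hu]
  rw [ptg_succ_smul hL, ptg_succ_block hL]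
  exact mul_inv_cancel _

/-- **THE TOP LEVEL IS UNCHANGED** by the pinned gauge: `W′_k = (W_k)^{1} = W_k`. [cite: Balaban1985RegularSpaces, (1.13)–(1.14) p.78] -/
theorem top_of_cov_pinned {L : ℕ} (hL : 1 ≤ L) (W W' : ℕ → Site d → Fin d → G) (k : ℕ)
    (hcov : W' k = gaugeAct (uLev L (ptg L W k k) k) (W k)) : W' k = W k := by
  rw [hcov, uLev_ptg_top hL, gaugeAct_one]

/-- `fl` commutes with coarse translations: `fl L (x + L·w) = fl L x + w`. [folklore] -/
private theorem fl_add_smul {L : ℕ} (hL : 1 ≤ L) (x w : Site d) : fl L (x + (L : ℤ) • w) = fl L x + w := by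
  funext i
  have hL0 : (L : ℤ) ≠ 0 := by exact_mod_cast (show L ≠ 0 by omega)
  simp only [fl, Pi.add_apply, Pi.smul_apply, smul_eq_mul]
  rw [show x i + (L : ℤ) * w i = x i + w i * (L : ℤ) by ring, Int.add_mul_ediv_right _ _ hL0]

/-- Translating both endpoints of a block contour by a period of the configuration does not change the transporter.
[folklore] -/
private theorem axialFn_add_of_periodic {V : Site d → Fin d → G} {a : Site d} (hV : shiftCfg a V = V) (y x : Site d) :
    axialFn V (y + a) (x + a) = axialFn V y x := by
  unfold axialFn
  rw [show x + a - (y + a) = x - y by abel, ← hol_shiftCfg a V y, hV]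

/-- **PERIODICITY OF THE PINNED TOWER GAUGE**: if the level-`j` configuration is `N·L^{k−j}`-periodic for every `j ≤ k` (the tower
of averages of an `N·Lᵏ`-periodic field, `avgIter_periodic`), then `u_{k−n} = ptg … n` is `N·Lⁿ`-periodic; in particular the fine
gauge `u = ptg … k` is `N·Lᵏ`-periodic — the gauge (1.14)/(1.15) of a configuration on the torus `T_η` (p. 77 (1.3)) read on `ℤᵈ`.
[cite: Balaban1985RegularSpaces, (1.14)–(1.15) p.78, (1.3) p.77] -/
theorem ptg_periodic {L : ℕ} (hL : 1 ≤ L) (W : ℕ → Site d → Fin d → G) (k N : ℕ)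
    (hW : ∀ j ≤ k, ∀ i : Fin d, shiftCfg (((N * L ^ (k - j) : ℕ) : ℤ) • e i) (W j) = W j) :
    ∀ n ≤ k, ∀ (x : Site d) (i : Fin d), ptg L W k n (x + ((N * L ^ n : ℕ) : ℤ) • e i) = ptg L W k n x
  | 0, _, x, i => by simp
  | n + 1, hn, x, i => by
    have hsplit : (((N * L ^ (n + 1) : ℕ) : ℤ)) • (e i : Site d) = (L : ℤ) • ((((N * L ^ n : ℕ) : ℤ)) • e i) := by
      rw [smul_smul]; congr 1; push_cast; ring
    have hper : shiftCfg (((N * L ^ (n + 1) : ℕ) : ℤ) • e i) (W (k - (n + 1))) = W (k - (n + 1)) := by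
      have h := hW (k - (n + 1)) (by omega) i
      rwa [show k - (k - (n + 1)) = n + 1 by omega] at h
    rw [ptg_succ, ptg_succ, hsplit, fl_add_smul hL, ptg_periodic hL W k N hW n (by omega) (fl L x) i, smul_add, ← hsplit,
      axialFn_add_of_periodic hper]

end Algebra

/-! ## §2. The pinned gauge fix on the tower of averages (43) of a small field (the analytic input is the tree's covariance
`B7AvgGaugeCovariance.avgIter_gaugeAct`, inside the domain of (21)–(22) of [3]) -/

section Analytic

variable {𝔸 : Type*} [NormedRing 𝔸] [NormOneClass 𝔸] [NormedAlgebra ℂ 𝔸] [CompleteSpace 𝔸]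

/-- The pinned tower gauge of the tower of averages `Ūʲ = avgIter L U j`, `j ≤ k`: `pinnedGauge L U k = ptg L (avgIter L U) k k`.
[cite: Balaban1985RegularSpaces, (1.14)–(1.15) p.78] -/
abbrev pinnedGauge (L : ℕ) (U : Site d → Fin d → 𝔸ˣ) (k : ℕ) : Site d → 𝔸ˣ :=
  ptg L (avgIter L U) k k

omit [NormOneClass 𝔸] in
/-- (1.14) on the whole top lattice: `pinnedGauge L U k (Lᵏz) = 1`. [cite: Balaban1985RegularSpaces, (1.14) p.78] -/
theorem pinnedGauge_top {L : ℕ} (hL : 1 ≤ L) (U : Site d → Fin d → 𝔸ˣ) (k : ℕ) (z : Site d) :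
    pinnedGauge L U k (((L : ℤ) ^ k) • z) = 1 :=
  ptg_top hL (avgIter L U) k z

/-- **EXISTENCE OF THE PINNED GAUGE (1.14) + (1.15), GLOBAL CARRIER.**  Let `G` be an `AvgClosed` gauge group, `L ≥ 2`, `U`
`G`-valued with (1.7) `sup_p |U(∂p) − 1| < α·L^{−2k}`, `α` Prop.-1∕2-small.  Then for `u := pinnedGauge L U k` and `U^{u}`: both are
`G`-valued; `sup_p |U^{u}(∂p) − 1| = sup_p |U(∂p) − 1|`; for every `j ≤ k`, `\overline{U^{u}}ʲ = (Ūʲ)^{u∘(Lʲ·)}` (p. 78); (1.15)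
holds between all consecutive levels: `\overline{U^{u}}ʲ(Γ_{Lz,x}) = 1`, `x ∈ B(Lz)`, all `z`, `j < k`; `u(Lᵏz) = 1` for ALL `z`; and
THE TOP AVERAGE IS KEPT: `\overline{U^{u}}ᵏ = Ūᵏ`. [cite: Balaban1985RegularSpaces, (1.13)–(1.15) p.78] -/
theorem pinnedFix_global (L : ℕ) (hL : 2 ≤ L) {G : Subgroup 𝔸ˣ} (hG : AvgClosed d L G) (k : ℕ)
    (U : Site d → Fin d → 𝔸ˣ) (hU : ∀ x κ, U x κ ∈ G) {α : ℝ} (hα : 0 < α)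
    (hα3 : C0 d * α ≤ 1 / 3) (hα2 : 2 * α ≤ c2' d L) (h17 : pdev U < α * (((L : ℝ) ^ k)⁻¹) ^ 2) :
    (∀ x, pinnedGauge L U k x ∈ G) ∧
    (∀ x κ, gaugeAct (pinnedGauge L U k) U x κ ∈ G) ∧
    pdev (gaugeAct (pinnedGauge L U k) U) = pdev U ∧
    (∀ j ≤ k, avgIter L (gaugeAct (pinnedGauge L U k) U) j = gaugeAct (uLev L (pinnedGauge L U k) j) (avgIter L U j)) ∧
    (∀ n, n < k → ∀ (z : Site d) (r : Fin d → Fin L),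
      axialFn (avgIter L (gaugeAct (pinnedGauge L U k) U) (k - (n + 1))) ((L : ℤ) • z) ((L : ℤ) • z + boxVec L r) = 1) ∧
    (∀ z : Site d, pinnedGauge L U k (((L : ℤ) ^ k) • z) = 1) ∧
    avgIter L (gaugeAct (pinnedGauge L U k) U) k = avgIter L U k := by
  have hL1 : 1 ≤ L := le_trans (by norm_num) hL
  have hmemG : ∀ j ≤ k, ∀ x μ, avgIter L U j x μ ∈ G := avgIter_mem L hL hG k U hU hα hα3 hα2 h17
  have huG : ∀ x, pinnedGauge L U k x ∈ G := fun x => ptg_mem hmemG k x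
  have huU : ∀ x, pinnedGauge L U k x ∈ U1 𝔸 := fun x => hG.le_U1 (huG x)
  have hcov : ∀ j ≤ k, avgIter L (gaugeAct (pinnedGauge L U k) U) j =
      gaugeAct (uLev L (pinnedGauge L U k) j) (avgIter L U j) :=
    avgIter_gaugeAct L hL hG k U hU huU hα hα3 hα2 h17
  exact ⟨huG, fun x κ => gaugeAct_mem_of hU huG x κ, pdev_gaugeAct huU U, hcov,
    fun n hn z r => h15_of_cov_pinned hL1 (avgIter L U) (avgIter L (gaugeAct (pinnedGauge L U k) U)) k hcov n hn z r,
    fun z => pinnedGauge_top hL1 U k z,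
    top_of_cov_pinned hL1 (avgIter L U) (avgIter L (gaugeAct (pinnedGauge L U k) U)) k (hcov k le_rfl)⟩

omit [NormOneClass 𝔸] in
/-- **THE TOWER OF AVERAGES OF A PERIODIC FIELD IS PERIODIC**: if `U` is `N·Lᵏ`-periodic then `Ūʲ` is `N·L^{k−j}`-periodic, `j ≤ k`
(translation covariance of (43), `B7TranslationCovariance.avgIter_shiftCfg`). [cite: Balaban1985Averaging, (43) p.24, p.19] -/
theorem avgIter_periodic (L N k : ℕ) {U : Site d → Fin d → 𝔸ˣ} (hU : ∀ i : Fin d, shiftCfg (((N * L ^ k : ℕ) : ℤ) • e i) U = U) :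
    ∀ j ≤ k, ∀ i : Fin d, shiftCfg (((N * L ^ (k - j) : ℕ) : ℤ) • e i) (avgIter L U j) = avgIter L U j := by
  intro j hj i
  funext z κ
  have hs : ((L : ℤ) ^ j) • ((((N * L ^ (k - j) : ℕ) : ℤ)) • (e i : Site d)) = (((N * L ^ k : ℕ) : ℤ)) • e i := by
    rw [smul_smul]; congr 1; push_cast
    rw [mul_left_comm, ← pow_add, show j + (k - j) = k by omega]
  rw [shiftCfg_apply, avgIter_shiftCfg L U j _ z κ, hs, hU i]

omit [NormOneClass 𝔸] in
/-- **THE PINNED GAUGE OF A PERIODIC FIELD IS PERIODIC**: `pinnedGauge L U k` is `N·Lᵏ`-periodic for `N·Lᵏ`-periodic `U` — the gauge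
(1.14)/(1.15) of a configuration on the torus `T_η` (p. 77 (1.3)) read on `ℤᵈ`. [cite: Balaban1985RegularSpaces, (1.14)–(1.15) p.78, (1.3) p.77] -/
theorem pinnedGauge_periodic {L : ℕ} (hL : 1 ≤ L) (N k : ℕ) {U : Site d → Fin d → 𝔸ˣ}
    (hU : ∀ i : Fin d, shiftCfg (((N * L ^ k : ℕ) : ℤ) • e i) U = U) (x : Site d) (i : Fin d) :
    pinnedGauge L U k (x + ((N * L ^ k : ℕ) : ℤ) • e i) = pinnedGauge L U k x :=
  ptg_periodic hL (avgIter L U) k N (avgIter_periodic L N k hU) k le_rfl x i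

/-! ## §3. The pinned axial gauge RELATIVE TO `U₀` ((1.19) with (1.14) on the whole top lattice) -/

/-- **THE PINNED GAUGE TRANSFORMATION SOLVING (1.19)**: `u := v₀⁻¹·v` with `v`, `v₀` the PINNED tower gauges of `U`, `U₀`
(cf. `B8Eq119TwistedAxial.twGauge`, whose top level is instead put in the axial gauge relative to `Ū₀ᵏ` at one point).
[cite: Balaban1985RegularSpaces, (1.19) p.79, (1.14) p.78] -/
def ptw (L : ℕ) (U₀ U : Site d → Fin d → 𝔸ˣ) (k : ℕ) : Site d → 𝔸ˣ :=
  (pinnedGauge L U₀ k)⁻¹ * pinnedGauge L U k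

omit [NormOneClass 𝔸] in
/-- `ptw_apply`: unfolding. [folklore] -/
private theorem ptw_apply (L : ℕ) (U₀ U : Site d → Fin d → 𝔸ˣ) (k : ℕ) (x : Site d) :
    ptw L U₀ U k x = (pinnedGauge L U₀ k x)⁻¹ * pinnedGauge L U k x := rfl

omit [NormOneClass 𝔸] in
/-- NORMALISATION (1.14) on the whole top lattice: `ptw L U₀ U k (Lᵏz) = 1` for every `z`. [cite: Balaban1985RegularSpaces, (1.14) p.78] -/
theorem ptw_top {L : ℕ} (hL : 1 ≤ L) (U₀ U : Site d → Fin d → 𝔸ˣ) (k : ℕ) (z : Site d) :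
    ptw L U₀ U k (((L : ℤ) ^ k) • z) = 1 := by
  rw [ptw_apply, pinnedGauge_top hL, pinnedGauge_top hL, inv_one, one_mul]

omit [NormOneClass 𝔸] in
/-- `ptw` is `N·Lᵏ`-periodic for `N·Lᵏ`-periodic `U₀`, `U` — the gauge (1.19) of configurations on the torus `T_η` (p. 77 (1.3)) read on
`ℤᵈ`. [cite: Balaban1985RegularSpaces, (1.19) p.79, (1.3) p.77] -/
theorem ptw_periodic {L : ℕ} (hL : 1 ≤ L) (N k : ℕ) {U₀ U : Site d → Fin d → 𝔸ˣ}
    (hU₀ : ∀ i : Fin d, shiftCfg (((N * L ^ k : ℕ) : ℤ) • e i) U₀ = U₀)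
    (hU : ∀ i : Fin d, shiftCfg (((N * L ^ k : ℕ) : ℤ) • e i) U = U) (x : Site d) (i : Fin d) :
    ptw L U₀ U k (x + ((N * L ^ k : ℕ) : ℤ) • e i) = ptw L U₀ U k x := by
  rw [ptw_apply, ptw_apply, pinnedGauge_periodic hL N k hU₀, pinnedGauge_periodic hL N k hU]

/-- **EXISTENCE OF THE PINNED GAUGE (1.19) WITH (1.14) ON THE WHOLE TOP LATTICE, GLOBAL CARRIER.**  Let `G` be an `AvgClosed`
gauge group, `L ≥ 2`, `U₀`, `U` `G`-valued with (1.7) `sup_p |·(∂p) − 1| < α·L^{−2k}`, `α` Prop.-1∕2-small.  Then for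
`u := ptw L U₀ U k` and `U^{u}`: both `G`-valued; `sup_p |U^{u}(∂p) − 1| = sup_p |U(∂p) − 1|`; `u(Lᵏz) = 1` for ALL `z`;
**(1.19) relative to `U₀` between ALL consecutive levels at EVERY block**: `\overline{U^{u}}ʲ(Γ_{Lz,x}) = Ū₀ʲ(Γ_{Lz,x})`, `x ∈ B(Lz)`,
all `z`, `j < k`; and THE TOP AVERAGE IS KEPT: `\overline{U^{u}}ᵏ = Ūᵏ`. [cite: Balaban1985RegularSpaces, (1.19) p.79, (1.13)–(1.14) p.78] -/
theorem pinnedTwistedFix_global (L : ℕ) (hL : 2 ≤ L) {G : Subgroup 𝔸ˣ} (hG : AvgClosed d L G) (k : ℕ)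
    (U₀ U : Site d → Fin d → 𝔸ˣ) (hU₀ : ∀ x κ, U₀ x κ ∈ G) (hU : ∀ x κ, U x κ ∈ G) {α : ℝ} (hα : 0 < α)
    (hα3 : C0 d * α ≤ 1 / 3) (hα2 : 2 * α ≤ c2' d L)
    (h33 : pdev U₀ < α * (((L : ℝ) ^ k)⁻¹) ^ 2) (h34 : pdev U < α * (((L : ℝ) ^ k)⁻¹) ^ 2) :
    (∀ x, ptw L U₀ U k x ∈ G) ∧
    (∀ x κ, gaugeAct (ptw L U₀ U k) U x κ ∈ G) ∧
    pdev (gaugeAct (ptw L U₀ U k) U) = pdev U ∧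
    (∀ z : Site d, ptw L U₀ U k (((L : ℤ) ^ k) • z) = 1) ∧
    (∀ n, n < k → ∀ (z : Site d) (r : Fin d → Fin L),
      axialFn (avgIter L (gaugeAct (ptw L U₀ U k) U) (k - (n + 1))) ((L : ℤ) • z) ((L : ℤ) • z + boxVec L r) =
        axialFn (avgIter L U₀ (k - (n + 1))) ((L : ℤ) • z) ((L : ℤ) • z + boxVec L r)) ∧
    avgIter L (gaugeAct (ptw L U₀ U k) U) k = avgIter L U k := by
  have hL1 : 1 ≤ L := le_trans (by norm_num) hL
  obtain ⟨hv₀G, -, -, hcov₀, h15₀, -, -⟩ := pinnedFix_global L hL hG k U₀ hU₀ hα hα3 hα2 h33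
  obtain ⟨hvG, hUvG, hpdev, -, h15, -, htop⟩ := pinnedFix_global L hL hG k U hU hα hα3 hα2 h34
  have huG : ∀ x, ptw L U₀ U k x ∈ G := fun x => G.mul_mem (G.inv_mem (hv₀G x)) (hvG x)
  have hv₀U : ∀ x, (pinnedGauge L U₀ k)⁻¹ x ∈ U1 𝔸 := fun x => hG.le_U1 (G.inv_mem (hv₀G x))
  have h17v : pdev (gaugeAct (pinnedGauge L U k) U) < α * (((L : ℝ) ^ k)⁻¹) ^ 2 := by rw [hpdev]; exact h34
  have hmul : gaugeAct (ptw L U₀ U k) U = gaugeAct (pinnedGauge L U₀ k)⁻¹ (gaugeAct (pinnedGauge L U k) U) :=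
    gaugeAct_mul _ _ _
  have hcov : ∀ j ≤ k, avgIter L (gaugeAct (ptw L U₀ U k) U) j =
      gaugeAct (uLev L (pinnedGauge L U₀ k)⁻¹ j) (avgIter L (gaugeAct (pinnedGauge L U k) U) j) := by
    rw [hmul]
    exact avgIter_gaugeAct L hL hG k _ hUvG hv₀U hα hα3 hα2 h17v
  refine ⟨huG, gaugeAct_mem_of hU huG, pdev_gaugeAct (fun x => hG.le_U1 (huG x)) U, fun z => ptw_top hL1 U₀ U k z,
    fun n hn z r => ?_, ?_⟩
  · have e₀ := h15₀ n hn z r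
    rw [hcov₀ _ (by omega), axialFn_gaugeAct] at e₀
    rw [hcov _ (by omega), axialFn_gaugeAct, h15 n hn z r, mul_one, eq_inv_mul_of_conj_eq_one e₀]
    simp only [uLev_apply, Pi.inv_apply, inv_inv]
  · rw [hcov k le_rfl, htop]
    have h1 : uLev L (pinnedGauge L U₀ k)⁻¹ k = 1 := by
      funext z
      rw [uLev_apply, Pi.inv_apply, pinnedGauge_top hL1, inv_one, Pi.one_apply]
    rw [h1, gaugeAct_one]

/-- Hence `U^{u} ∈ Ax_k(ℭ, U₀)` for EVERY family `ℭ` of constraint sets, `u = ptw L U₀ U k` — the second clause of (1.34) for the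
pinned gauge. [cite: Balaban1985RegularSpaces, (1.34) p.82, (1.19) p.79] -/
theorem inAx_pinnedTwistedFix (L : ℕ) (hL : 2 ≤ L) {G : Subgroup 𝔸ˣ} (hG : AvgClosed d L G) (k : ℕ)
    (U₀ U : Site d → Fin d → 𝔸ˣ) (hU₀ : ∀ x κ, U₀ x κ ∈ G) (hU : ∀ x κ, U x κ ∈ G) {α : ℝ} (hα : 0 < α)
    (hα3 : C0 d * α ≤ 1 / 3) (hα2 : 2 * α ≤ c2' d L)
    (h33 : pdev U₀ < α * (((L : ℝ) ^ k)⁻¹) ^ 2) (h34 : pdev U < α * (((L : ℝ) ^ k)⁻¹) ^ 2) (Λ : ℕ → Set (Site d)) :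
    InAx L k Λ U₀ (gaugeAct (ptw L U₀ U k) U) :=
  inAx_of_global (pinnedTwistedFix_global L hL hG k U₀ U hU₀ hU hα hα3 hα2 h33 h34).2.2.2.2.1 Λ

/-! ## §4. THE PAIR WITH EQUAL `k`-TH AVERAGES: (1.35) with `α₁ = 0`, hence (1.65)/(1.66) with `α₁ = 0` -/

/-- **AT THE PAIR THE CONSTRAINT IS KEPT**: if `Ūᵏ = Ū₀ᵏ` (both configurations in `𝔅_k(𝔅_k, V)`, B11 (13)) then after the pinned
gauge `\overline{U^{u}}ᵏ = Ū₀ᵏ` still — (1.35) at level `k` with `α₁ = 0`. [cite: Balaban1985RegularSpaces, (1.13)–(1.14) p.78, (1.35) p.82; Balaban1985Variational, (13) p.280] -/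
theorem avgIter_pinnedTwistedFix_eq (L : ℕ) (hL : 2 ≤ L) {G : Subgroup 𝔸ˣ} (hG : AvgClosed d L G) (k : ℕ)
    (U₀ U : Site d → Fin d → 𝔸ˣ) (hU₀ : ∀ x κ, U₀ x κ ∈ G) (hU : ∀ x κ, U x κ ∈ G) {α : ℝ} (hα : 0 < α)
    (hα3 : C0 d * α ≤ 1 / 3) (hα2 : 2 * α ≤ c2' d L)
    (h33 : pdev U₀ < α * (((L : ℝ) ^ k)⁻¹) ^ 2) (h34 : pdev U < α * (((L : ℝ) ^ k)⁻¹) ^ 2)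
    (hpair : avgIter L U k = avgIter L U₀ k) :
    avgIter L (gaugeAct (ptw L U₀ U k) U) k = avgIter L U₀ k := by
  rw [(pinnedTwistedFix_global L hL hG k U₀ U hU₀ hU hα hα3 hα2 h33 h34).2.2.2.2.2, hpair]

omit [NormOneClass 𝔸] [NormedAlgebra ℂ 𝔸] [CompleteSpace 𝔸] in
/-- Every bond `⟨x, x + e_ν⟩` of the depth-`n` lattice lies in SOME tower of cubes `[tlo L lo n, thi L hi n]` of `B8Ineq130`
(take the top cube `[−A·𝟙, A·𝟙]`, `A = Σᵢ|xᵢ| + 1`). [folklore] -/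
private theorem exists_box {L : ℕ} (hL : 1 ≤ L) (n : ℕ) (x : Site d) (ν : Fin d) :
    ∃ lo hi : Site d, tlo L lo n ≤ x ∧ x + e ν ≤ thi L hi n := by
  set A : ℤ := ∑ i, |x i| + 1 with hA
  have hAi : ∀ i, |x i| + 1 ≤ A := fun i => by
    rw [hA]
    have := Finset.single_le_sum (f := fun i => |x i|) (fun i _ => abs_nonneg (x i)) (Finset.mem_univ i)
    linarith
  have hLn : (1 : ℤ) ≤ (L : ℤ) ^ n := one_le_pow₀ (by exact_mod_cast hL)
  refine ⟨fun _ => -A, fun _ => A, fun i => ?_, fun i => ?_⟩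
  · rw [tlo_apply]
    have h1 := hAi i
    have h2 := neg_abs_le (x i)
    have hA0 : 0 ≤ A := by linarith [abs_nonneg (x i)]
    nlinarith
  · rw [thi_apply]
    simp only [Pi.add_apply]
    have h1 := hAi i
    have h2 := le_abs_self (x i)
    have he : (e ν : Site d) i ≤ 1 := by
      rw [e_apply]; split_ifs <;> norm_num
    have hA0 : 0 ≤ A + 1 := by linarith [abs_nonneg (x i)]
    nlinarith

/-- **(1.65) AT THE PAIR** — for `G`-valued `U₀`, `U` with (1.7) `sup_p |·(∂p) − 1| < α·L^{−2k}` (`α` Prop.-1∕2-small and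
`11d²α ≤ 1∕6`) and EQUAL `k`-th averages `Ūᵏ = Ū₀ᵏ`, in the pinned axial gauge `u = ptw L U₀ U k` relative to `U₀`:
`|\overline{U^{u}}ʲ_b − Ū₀ʲ_b| ≤ 8d²α(1 + L⁻² + … + L^{−2(k−j−1)}) < 11d²α` on EVERY bond `b` of the `j`-lattice, `j = k − n ≤ k` — the printed
(1.65) with `α₁ = 0` (iterated Lemma 1, `B8Ineq165Descent.ineq165_global`). [cite: Balaban1985RegularSpaces, (1.65) p.87, Lemma 1 (1.25) p.79] -/
theorem ineq165_pair (L : ℕ) (hL : 2 ≤ L) (hd : 1 ≤ d) {G : Subgroup 𝔸ˣ} (hG : AvgClosed d L G) (k : ℕ)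
    (U₀ U : Site d → Fin d → 𝔸ˣ) (hU₀ : ∀ x κ, U₀ x κ ∈ G) (hU : ∀ x κ, U x κ ∈ G) {α : ℝ} (hα : 0 < α)
    (hα3 : C0 d * α ≤ 1 / 3) (hα2 : 2 * α ≤ c2' d L)
    (h33 : pdev U₀ < α * (((L : ℝ) ^ k)⁻¹) ^ 2) (h34 : pdev U < α * (((L : ℝ) ^ k)⁻¹) ^ 2)
    (hpair : avgIter L U k = avgIter L U₀ k) (hsmall : 11 * (d : ℝ) ^ 2 * α ≤ 1 / 6)
    (n : ℕ) (hn : n ≤ k) (x : Site d) (ν : Fin d) :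
    ‖((avgIter L (gaugeAct (ptw L U₀ U k) U) (k - n) x ν : 𝔸ˣ) : 𝔸) - avgIter L U₀ (k - n) x ν‖ ≤
        8 * (d : ℝ) ^ 2 * α * (∑ m ∈ Finset.range n, (((L : ℝ) ^ m)⁻¹) ^ 2) ∧
      8 * (d : ℝ) ^ 2 * α * (∑ m ∈ Finset.range n, (((L : ℝ) ^ m)⁻¹) ^ 2) < 11 * (d : ℝ) ^ 2 * α := by
  have hL1 : 1 ≤ L := le_trans (by norm_num) hL
  obtain ⟨-, hUuG, hpdev, -, h19, hkeep⟩ := pinnedTwistedFix_global L hL hG k U₀ U hU₀ hU hα hα3 hα2 h33 h34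
  have h34' : pdev (gaugeAct (ptw L U₀ U k) U) < α * (((L : ℝ) ^ k)⁻¹) ^ 2 := by rw [hpdev]; exact h34
  obtain ⟨lo, hi, hx, hxν⟩ := exists_box hL1 n x ν
  have h35 : ∀ y μ, lo ≤ y → y + e μ ≤ hi →
      ‖((avgIter L (gaugeAct (ptw L U₀ U k) U) k y μ : 𝔸ˣ) : 𝔸) - avgIter L U₀ k y μ‖ ≤ 0 := fun y μ _ _ => by
    rw [hkeep, hpair, sub_self, norm_zero]
  have h := ineq165_global L hL hd hG k U₀ (gaugeAct (ptw L U₀ U k) U) hU₀ hUuG hα hα3 hα2 h33 h34' lo hi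
    (fun m hm z _ _ r => h19 m hm z r) h35 le_rfl (by linarith) n hn x ν hx hxν
  simp only [add_zero] at h
  exact h

/-- **(1.66) AT THE PAIR** (the perturbation form, `Ũ′ʲ = pert (\overline{U^{u}}ʲ) (Ū₀ʲ)` (1.20)): under the hypotheses of `ineq165_pair`,
`|Ũ′ʲ_b − 1| < 11d²α` on EVERY bond of every level `j = k − n ≤ k` — the hypothesis (1.66) of Theorem 4 (p. 88) for the pair
`(U₀, U^{u}·U₀⁻¹·U₀) = (U₀, U^{u})` with `α₁ := 11d²α`, the level-`k` closeness being EXACT. [cite: Balaban1985RegularSpaces, (1.66) p.87, Thm 4 p.88] -/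
theorem ineq166_pair (L : ℕ) (hL : 2 ≤ L) (hd : 1 ≤ d) {G : Subgroup 𝔸ˣ} (hG : AvgClosed d L G) (k : ℕ)
    (U₀ U : Site d → Fin d → 𝔸ˣ) (hU₀ : ∀ x κ, U₀ x κ ∈ G) (hU : ∀ x κ, U x κ ∈ G) {α : ℝ} (hα : 0 < α)
    (hα3 : C0 d * α ≤ 1 / 3) (hα2 : 2 * α ≤ c2' d L)
    (h33 : pdev U₀ < α * (((L : ℝ) ^ k)⁻¹) ^ 2) (h34 : pdev U < α * (((L : ℝ) ^ k)⁻¹) ^ 2)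
    (hpair : avgIter L U k = avgIter L U₀ k) (hsmall : 11 * (d : ℝ) ^ 2 * α ≤ 1 / 6)
    (n : ℕ) (hn : n ≤ k) (x : Site d) (ν : Fin d) :
    ‖((pert (avgIter L (gaugeAct (ptw L U₀ U k) U) (k - n)) (avgIter L U₀ (k - n)) x ν : 𝔸ˣ) : 𝔸) - 1‖ < 11 * (d : ℝ) ^ 2 * α := by
  have hL1 : 1 ≤ L := le_trans (by norm_num) hL
  obtain ⟨-, hUuG, hpdev, -, h19, hkeep⟩ := pinnedTwistedFix_global L hL hG k U₀ U hU₀ hU hα hα3 hα2 h33 h34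
  have h34' : pdev (gaugeAct (ptw L U₀ U k) U) < α * (((L : ℝ) ^ k)⁻¹) ^ 2 := by rw [hpdev]; exact h34
  obtain ⟨lo, hi, hx, hxν⟩ := exists_box hL1 n x ν
  have h35 : ∀ y μ, lo ≤ y → y + e μ ≤ hi →
      ‖((avgIter L (gaugeAct (ptw L U₀ U k) U) k y μ : 𝔸ˣ) : 𝔸) - avgIter L U₀ k y μ‖ ≤ 0 := fun y μ _ _ => by
    rw [hkeep, hpair, sub_self, norm_zero]
  have h := ineq165_global_pert L hL hd hG k U₀ (gaugeAct (ptw L U₀ U k) U) hU₀ hUuG hα hα3 hα2 h33 h34' lo hi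
    (fun m hm z _ _ r => h19 m hm z r) h35 le_rfl (by linarith) n hn x ν hx hxν
  simp only [add_zero] at h
  exact h

/-- **THE RELATIVE PERTURBATION ON THE FINE LATTICE** (level `0`, the bound Theorem 4's induction starts from and the INPUT `r₀` of row
NE3's frame normalisation ∕ Landau step): `|U^{u}_b·U₀,b⁻¹ − 1| < 11d²α` and `|U^{u}_b − U₀,b| < 11d²α` on every fine bond.
[cite: Balaban1985RegularSpaces, (1.66) p.87 (j = 0)] -/
theorem fine_pair (L : ℕ) (hL : 2 ≤ L) (hd : 1 ≤ d) {G : Subgroup 𝔸ˣ} (hG : AvgClosed d L G) (k : ℕ)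
    (U₀ U : Site d → Fin d → 𝔸ˣ) (hU₀ : ∀ x κ, U₀ x κ ∈ G) (hU : ∀ x κ, U x κ ∈ G) {α : ℝ} (hα : 0 < α)
    (hα3 : C0 d * α ≤ 1 / 3) (hα2 : 2 * α ≤ c2' d L)
    (h33 : pdev U₀ < α * (((L : ℝ) ^ k)⁻¹) ^ 2) (h34 : pdev U < α * (((L : ℝ) ^ k)⁻¹) ^ 2)
    (hpair : avgIter L U k = avgIter L U₀ k) (hsmall : 11 * (d : ℝ) ^ 2 * α ≤ 1 / 6) (x : Site d) (ν : Fin d) :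
    ‖((pert (gaugeAct (ptw L U₀ U k) U) U₀ x ν : 𝔸ˣ) : 𝔸) - 1‖ < 11 * (d : ℝ) ^ 2 * α ∧
      ‖((gaugeAct (ptw L U₀ U k) U x ν : 𝔸ˣ) : 𝔸) - U₀ x ν‖ < 11 * (d : ℝ) ^ 2 * α := by
  have h1 := ineq166_pair L hL hd hG k U₀ U hU₀ hU hα hα3 hα2 h33 h34 hpair hsmall k le_rfl x ν
  have h2 := ineq165_pair L hL hd hG k U₀ U hU₀ hU hα hα3 hα2 h33 h34 hpair hsmall k le_rfl x ν
  simp only [Nat.sub_self, avgIter_zero] at h1 h2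
  exact ⟨h1, h2.1.trans_lt h2.2⟩

/-- **SUMMARY AT THE PAIR, BY ONE NAME** (for consumers; everything above packaged existentially): for `G`-valued `U₀`, `U` with
(1.7) `sup_p |·(∂p) − 1| < α·L^{−2k}` (`α` Prop.-1∕2-small, `11d²α ≤ 1∕6`), `N·Lᵏ`-periodic, with EQUAL `k`-th averages, there is a
`G`-valued `N·Lᵏ`-periodic gauge transformation `u` with `u(Lᵏz) = 1` for all `z` ((1.14)), `U^{u}` `G`-valued with the same
plaquette deviation, (1.19) relative to `U₀` between all consecutive levels at every block ((1.34)), the top average kept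
(`\overline{U^{u}}ᵏ = Ūᵏ = Ū₀ᵏ`, (1.35) with `α₁ = 0`), and (1.66) with `α₁ = 0`: `|Ũ′ʲ_b − 1| < 11d²α` on every bond of every level.
[cite: Balaban1985RegularSpaces, (1.14) p.78, (1.19) p.79, (1.34)–(1.35) p.82, (1.66) p.87] -/
theorem exists_pinned_pair (L : ℕ) (hL : 2 ≤ L) (hd : 1 ≤ d) {G : Subgroup 𝔸ˣ} (hG : AvgClosed d L G) (k N : ℕ)
    (U₀ U : Site d → Fin d → 𝔸ˣ) (hU₀ : ∀ x κ, U₀ x κ ∈ G) (hU : ∀ x κ, U x κ ∈ G) {α : ℝ} (hα : 0 < α)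
    (hα3 : C0 d * α ≤ 1 / 3) (hα2 : 2 * α ≤ c2' d L)
    (h33 : pdev U₀ < α * (((L : ℝ) ^ k)⁻¹) ^ 2) (h34 : pdev U < α * (((L : ℝ) ^ k)⁻¹) ^ 2)
    (hU₀P : ∀ i : Fin d, shiftCfg (((N * L ^ k : ℕ) : ℤ) • e i) U₀ = U₀)
    (hUP : ∀ i : Fin d, shiftCfg (((N * L ^ k : ℕ) : ℤ) • e i) U = U)
    (hpair : avgIter L U k = avgIter L U₀ k) (hsmall : 11 * (d : ℝ) ^ 2 * α ≤ 1 / 6) :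
    ∃ u : Site d → 𝔸ˣ,
      (∀ x, u x ∈ G) ∧ (∀ (x : Site d) (i : Fin d), u (x + ((N * L ^ k : ℕ) : ℤ) • e i) = u x) ∧
      (∀ z : Site d, u (((L : ℤ) ^ k) • z) = 1) ∧
      (∀ x κ, gaugeAct u U x κ ∈ G) ∧ pdev (gaugeAct u U) = pdev U ∧
      (∀ n, n < k → ∀ (z : Site d) (r : Fin d → Fin L),
        axialFn (avgIter L (gaugeAct u U) (k - (n + 1))) ((L : ℤ) • z) ((L : ℤ) • z + boxVec L r) =
          axialFn (avgIter L U₀ (k - (n + 1))) ((L : ℤ) • z) ((L : ℤ) • z + boxVec L r)) ∧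
      avgIter L (gaugeAct u U) k = avgIter L U₀ k ∧
      (∀ n, n ≤ k → ∀ (x : Site d) (ν : Fin d),
        ‖((pert (avgIter L (gaugeAct u U) (k - n)) (avgIter L U₀ (k - n)) x ν : 𝔸ˣ) : 𝔸) - 1‖ < 11 * (d : ℝ) ^ 2 * α) := by
  have hL1 : 1 ≤ L := le_trans (by norm_num) hL
  obtain ⟨huG, hUuG, hpdev, htop, h19, -⟩ := pinnedTwistedFix_global L hL hG k U₀ U hU₀ hU hα hα3 hα2 h33 h34
  exact ⟨ptw L U₀ U k, huG, ptw_periodic hL1 N k hU₀P hUP, htop, hUuG, hpdev, h19,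
    avgIter_pinnedTwistedFix_eq L hL hG k U₀ U hU₀ hU hα hα3 hα2 h33 h34 hpair,
    fun n hn x ν => ineq166_pair L hL hd hG k U₀ U hU₀ hU hα hα3 hα2 h33 h34 hpair hsmall n hn x ν⟩

end Analytic

end Literature.MathematicalPhysics.QuantumFieldTheory.Balaban1983to89.B8Eq166ConstraintPair

end
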